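import Summits.BirchSwinnertonDyer.BirchSwinnertonDyer.Theorems.TameQuarticManinParityModThreeSaturationOfAvoids
import Summits.BirchSwinnertonDyer.BirchSwinnertonDyer.Theorems.TameQuarticManinParityPrymDefectAvoidsThreeOfEisensteinSplit
import Summits.BirchSwinnertonDyer.BirchSwinnertonDyer.Theorems.TameQuarticManinParityIrrModThreeSplitTraceWitness
import Summits.BirchSwinnertonDyer.BirchSwinnertonDyer.Theorems.TameQuarticManinParityEisensteinSplitOfShiftDatum
import HarnessLib

/-!
# Route `TameQuarticManinParity`: the crux MS `TprimeIrrModThreeSaturation` (stmt-BirchSwinnertonDyer-23367) from H1 and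
# ONE named fact — current state of LINE `abelian-fixed-points`

Lead seat `cruxlead-stmt-BirchSwinnertonDyer-23367` g0. Composition of the landed pieces: MS ⇐ A29 ⇐ H1 ∧ H2 (p673284),
H2 ⇐ E30 ∧ B30 (p673875), B30 PROVED (p675317, `stub_traceWitness`), E30 ⇐ the named fact
`Literature.NumberTheory.EllipticCurves.nonempty_shiftDatumEichlerShimuraFixedFrobenius` (p676603/p676604). Hence
**MS ⇐ H1 (`TprimeIrrNormImageAvoidsThree`, stmt-23479) ∧ that fact**, kernel-checked here. CONDITIONAL; glue only; no
summit is proved; BSD is NOT proved by this file.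
-/

set_option autoImplicit false
-- D-0017: single-problem summit, so `Summit.BirchSwinnertonDyer.BirchSwinnertonDyer.…` repeats a namespace BY DESIGN.
set_option linter.dupNamespace false

noncomputable section

namespace Summit.BirchSwinnertonDyer.BirchSwinnertonDyer.Theorems.TameQuarticManinParity

/-- **MS ⇐ H1 ∧ (ℚ-structure fact)**: `TprimeIrrModThreeSaturation` (stmt-BirchSwinnertonDyer-23367) follows from
`TprimeIrrNormImageAvoidsThree` (H1, stmt-23479) and the named fact
`nonempty_shiftDatumEichlerShimuraFixedFrobenius` (Galois structure of `J₀(N)` with shift, Eichler–Shimura on `J₀(N)[3]`,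
Frobenius at `p ≡ 1 (mod N)` trivial on `π₀(J^t)`), through E30 (`eisensteinSplit_of_shiftDatum`), B30
(`stub_traceWitness`, proved), H2 and A29. Conditional glue. [cite: DarmonDiamondTaylor1995, Thm. 1.29 (p. 37)] -/
theorem tprimeIrrModThreeSaturation_of_normImage_of_shiftDatum
    (h1 : Theses.TameQuarticManinParity.TprimeIrrNormImageAvoidsThree)
    (hF : Literature.NumberTheory.EllipticCurves.nonempty_shiftDatumEichlerShimuraFixedFrobenius) :
    Theses.TameQuarticManinParity.TprimeIrrModThreeSaturation :=
  modThreeSaturation_of_fixedPartAvoidsThree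
    (fixedPartAvoidsThree_of_normImage_of_prymDefect h1
      (prymDefectAvoidsThree_of_eisensteinSplit_of_traceWitness (eisensteinSplit_of_shiftDatum hF) stub_traceWitness))

end Summit.BirchSwinnertonDyer.BirchSwinnertonDyer.Theorems.TameQuarticManinParity

end
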